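import Literature.AnabelianGeometry.EtaleTheta.TemperedFrobenioidOfRankOneBase
import Literature.AnabelianGeometry.EtaleTheta.TemperedFrobenioidOfRankOneObject
import Literature.AnabelianGeometry.EtaleTheta.TemperedFrobenioidOfGaloisCoveringTateTower
import Literature.AlgebraicGeometry.Frobenioids.PerfFactorialPrimes
import Literature.AlgebraicGeometry.Frobenioids.PadicFrobenioidUnitGroups
import HarnessLib

/-!
# [EtTh] Def. 3.6 (ii) / Def. 4.1 (i): the «coprimality-pull-back law» of the divisor monoid `Φ` as a NAMED PREDICATE
# of record (`TemperedFrobenioid.CoprimePullLaw`), with its REGISTER: holds at every rank-one tempered Frobenioid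

S. Mochizuki, *The étale theta function …*, Publ. RIMS **45** (2009) [MochizukiEtTh2009], §3 Def. 3.6 (ii) p.77, §4
Def. 4.1 (i) p.86 («`Div(s′)`, `Div(s″)` have disjoint supports [cf. [FrdI], Proposition 4.1, (iii)]») and the proof of
Prop. 4.2 (iii) pp.89–90 (the root's fraction-pair over the covering again has disjoint supports)
[cite: MochizukiEtTh2009, Def 4.1 (i) p.86]; [FrdI] = [MochizukiFrdI2008] Def. 1.1 (ii) p.19, Prop. 4.1 (iii).

abc-iut cell, layer L2; seat abc-iut-L2-t3 (gen 6), owner lineage of `TemperedFrobenioid` (the census predicates A6/A7/A9/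
A10 of `TemperedFrobenioidLaws.lean` are this lineage's).  CLASS (c): ONE `Prop`-valued predicate over EXISTING fields —
the binder of GAP-LEDGER row **G-w5d063-1** (`hDSpull`, carried BY NAME since abc-iut-w4-d044's
`Prop42Sub.prop42_iii_iv_mkOfModelCanonical_of_laws`, p428253, by every law-level closer of Prop. 4.2 (iii)) — plus its
register as THEOREMS:
* `TemperedFrobenioid.CoprimePullLaw C` — VERBATIM `hDSpull`: for every arrow `e : A′ ⟶ A` of `D` and `a, b ∈ Φ(A)`
  with no common non-trivial divisor, `Φ(e) a`, `Φ(e) b ∈ Φ(A′)` have no common non-trivial divisor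
  (`coprimePullLaw_iff` = `Iff.rfl` with the consumers' binder shape);
* SUFFICIENT CRITERIA: `coprimePullLaw_of_dvd_total` (every `Φ(A)` totally ordered by divisibility and sharp — then
  «coprime» means «one of the two is trivial»), `coprimePullLaw_of_isMonoprime` (every `Φ(A)` monoprime, [FrdI] §0),
  `coprimePullLaw_restrict` (the law restricts along any functor of bases, [FrdI] Prop. 1.6);
* REGISTER ✓ at EVERY rank-one tempered Frobenioid of record: abc-iut-w6-d048's engines `ofRankOneBase` (any base
  functor with rank-one values) and `ofRankOnePoint` (+ its re-basing to `B^temp(Π)⁰`), abc-iut-w5-d179's `dm`-generic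
  `ofRankOneObject` (+ re-basing), and the MODEL OF RECORD `TateTowerFrd.temperedFrobenioid` (abc-iut-w6-d058's Tate
  tower): `coprimePullLaw_ofRankOneBase / _ofRankOnePoint(_connectedPart) / _ofRankOneObject(_connectedPart) /
  TateTowerFrd.coprimePullLaw_temperedFrobenioid`;
* REGISTER ✗: the law is NOT a consequence of the typed structure — abc-iut-L2-t3's `ShearToy.not_coprimePull`
  (`TemperedFrobenioidToyShear.lean`: a Galois double cover whose divisor pull-back is a shear; rank two) — so it is a
  genuine law of the base data (v-next FIELD candidate of Def. 3.6 (ii) / [FrdI] Def. 1.1 (ii), G-w5d063-1), dischargeable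
  at higher rank only from the geometry of the datum (e.g. pointwise minima of equivariant divisors at abc-iut-w5-d179's
  `DiagonalBase` data — not here).
HONEST FRAMING: a named assumption-shape and register over OUR typed interfaces; nothing asserted about tempered
Frobenioids of curves; nothing here bears on the disputed [IUTchIII] Cor. 3.12; no side taken; typed ≠ proved.
-/

namespace Literature.AnabelianGeometry.EtaleTheta

open CategoryTheory Opposite Function Literature.AlgebraicGeometry.Frobenioids
  Literature.AnabelianGeometry.SemiGraphs

universe u₀ v₀ u v u' v' w

namespace TemperedFrobenioid

section Law

variable {D₀ : Type u₀} [Category.{v₀} D₀] {V : FrdIMonoidStub.{w}} {T : RealifiedDivisorMonoids (D₀ := D₀) V}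
  {D : Type u} [Category.{v} D] {VD : FrdICatStub.{u, v, w} D} (C : TemperedFrobenioid T D VD)

/-- **The coprimality-pull-back law** of the divisor monoid `Φ` of Def. 3.6 (ii) data ([EtTh] Def. 4.1 (i) with
[FrdI] Prop. 4.1 (iii); GAP G-w5d063-1, binder `hDSpull` verbatim): for every arrow `e : A′ → A` of `D` and all
`a, b ∈ Φ(A)` without common non-trivial divisor, the pull-backs `Φ(e) a, Φ(e) b ∈ Φ(A′)` have no common non-trivial
divisor («if `Div(s′)`, `Div(s″)` have disjoint supports, so do their pull-backs»). [cite: MochizukiEtTh2009, Def 4.1 (i) p.86] -/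
def CoprimePullLaw : Prop :=
  ∀ ⦃A A' : D⦄ (e : A' ⟶ A) ⦃a b : C.Φ.carrier (op A)⦄,
    (∀ x : C.Φ.carrier (op A), x ∣ a → x ∣ b → x = 1) →
      ∀ y : C.Φ.carrier (op A'), y ∣ pull C.divisorMonoid e a → y ∣ pull C.divisorMonoid e b → y = 1

/-- `CoprimePullLaw` IS the consumers' binder `hDSpull` (same statement, binder shape of p428253).
[cite: MochizukiEtTh2009, Def 4.1 (i) p.86] -/
theorem coprimePullLaw_iff :
    C.CoprimePullLaw ↔ ∀ {A A' : D} (e : A' ⟶ A) {a b : C.Φ.carrier (op A)},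
      (∀ x : C.Φ.carrier (op A), x ∣ a → x ∣ b → x = 1) →
        ∀ y : C.Φ.carrier (op A'), y ∣ pull C.divisorMonoid e a → y ∣ pull C.divisorMonoid e b → y = 1 :=
  Iff.rfl

/-- **Criterion 1**: if every `Φ(A)` is sharp and totally ordered by divisibility, the law holds — «coprime» then forces
one of the two elements to be trivial, and pull-back preserves `1`. [cite: MochizukiEtTh2009, Def 4.1 (i) p.86] -/
theorem coprimePullLaw_of_dvd_total (htot : ∀ (A : Dᵒᵖ) (a b : C.Φ.carrier A), a ∣ b ∨ b ∣ a)
    (hsh : ∀ A : Dᵒᵖ, IsSharp (C.Φ.carrier A)) : C.CoprimePullLaw := by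
  intro A A' e a b hab y hya hyb
  rcases htot (op A) a b with h | h
  · have ha : pull C.divisorMonoid e a = 1 := by rw [hab a (dvd_refl a) h]; exact map_one _
    rw [ha] at hya
    exact (hsh (op A')).1 y (isUnit_of_dvd_one hya)
  · have hb : pull C.divisorMonoid e b = 1 := by rw [hab b h (dvd_refl b)]; exact map_one _
    rw [hb] at hyb
    exact (hsh (op A')).1 y (isUnit_of_dvd_one hyb)

/-- **Criterion 2**: if every `Φ(A)` is monoprime ([FrdI] §0: `≅ ℤ_{≥0}`, `ℚ_{≥0}` or `ℝ_{≥0}`), the law holds.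
[cite: MochizukiEtTh2009, Def 4.1 (i) p.86] -/
theorem coprimePullLaw_of_isMonoprime (h : ∀ A : Dᵒᵖ, IsMonoprime (C.Φ.carrier A)) : C.CoprimePullLaw :=
  C.coprimePullLaw_of_dvd_total (fun A a b => (h A).dvd_total a b) fun A => (h A).isSharp

end Law

section Restrict

variable {D₀ : Type u₀} [Category.{v₀} D₀] {V : FrdIMonoidStub.{w}} {T : RealifiedDivisorMonoids (D₀ := D₀) V}
  {D : Type u} [Category.{v} D] {IsRational IsStrictlyRational : (Dᵒᵖ ⥤ CommMonCat.{w}) → Prop}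
  (C : TemperedFrobenioid T D (treeCatVocab D IsRational IsStrictlyRational))
  {D' : Type u'} [Category.{v'} D'] (G : D' ⥤ D) (IsRational' IsStrictlyRational' : (D'ᵒᵖ ⥤ CommMonCat.{w}) → Prop)

/-- **Criterion 3**: the law restricts along any functor of base categories `G : D′ → D` ([FrdI] Prop. 1.6: `Φ|_{D′}`
has the values `Φ(G A)` and the pull-backs `Φ(G f)`). [cite: MochizukiFrdI2008, Prop. 1.6 p.27] -/
theorem coprimePullLaw_restrict (hc : IsConnected D') (hte : IsTotallyEpimorphic D')
    (hG : ∀ {A B : D'} (f : B ⟶ A), IsFSM f → IsFSM (G.map f)) (h : C.CoprimePullLaw) :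
    (C.restrict G IsRational' IsStrictlyRational' hc hte hG).CoprimePullLaw :=
  fun _ _ e _ _ hab y hya hyb => h (G.map e) hab y hya hyb

/-- The law restricts along any functor from a base of FSM-type. [cite: MochizukiFrdI2008, Prop. 1.6 p.27] -/
theorem coprimePullLaw_restrictOfFSMType (hc : IsConnected D') (hte : IsTotallyEpimorphic D') (hD' : IsOfFSMType D')
    (h : C.CoprimePullLaw) : (C.restrictOfFSMType G IsRational' IsStrictlyRational' hc hte hD').CoprimePullLaw :=
  fun _ _ e _ _ hab y hya hyb => h (G.map e) hab y hya hyb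

end Restrict

/-! ### Register ✓: every rank-one tempered Frobenioid of record -/

section RankOneBase

variable {D₀ : Type u₀} [Category.{v₀} D₀] {dm : DivisorMonoids.{u₀, v₀, w} D₀}
  (hpf : ∀ Y : D₀ᵒᵖ, IsPerfFactorialCof (dm.Φ₀.obj Y)) {D : Type u} [Category.{v} D] (P : RankOneBase dm D)
  (hD : IsConnected D) (hD' : IsTotallyEpimorphic D) (hFSM : IsOfFSMType D) (R S : (Dᵒᵖ ⥤ CommMonCat.{w}) → Prop)

/-- **✓ at abc-iut-w6-d048's engine `ofRankOneBase`** (any base functor with rank-one values; `Φ(A) = im(ℤ_{≥0}^pf → rlf)`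
is monoprime). [cite: MochizukiEtTh2009, Def 4.1 (i) p.86] -/
theorem coprimePullLaw_ofRankOneBase : (ofRankOneBase hpf P hD hD' hFSM R S).CoprimePullLaw :=
  coprimePullLaw_of_isMonoprime _ fun A => P.isMonoprime_pfImage hpf A

end RankOneBase

section RankOneObject

variable {D₀ : Type u₀} [Category.{v₀} D₀] {dm : DivisorMonoids.{u₀, v₀, 0} D₀} (P : dm.RankOneObject)
  (hpf : ∀ Y : D₀ᵒᵖ, IsPerfFactorialCof (dm.Φ₀.obj Y)) (R S : ((Discrete PUnit.{1})ᵒᵖ ⥤ CommMonCat.{0}) → Prop)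
  (Γ : Type) [Group Γ] [TopologicalSpace Γ] (R' S' : ((ConnectedPart (BTemp Γ))ᵒᵖ ⥤ CommMonCat.{0}) → Prop)

/-- **✓ at abc-iut-w5-d179's `dm`-generic engine `ofRankOneObject`**. [cite: MochizukiEtTh2009, Def 4.1 (i) p.86] -/
theorem coprimePullLaw_ofRankOneObject : (ofRankOneObject P hpf R S).CoprimePullLaw :=
  coprimePullLaw_of_isMonoprime _ fun _ => P.isMonoprime_pfImage hpf

/-- ✓ at its re-basing to the genuine base `B^temp(Π)⁰`. [cite: MochizukiEtTh2009, Def 4.1 (i) p.86] -/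
theorem coprimePullLaw_ofRankOneObjectConnectedPart : (ofRankOneObjectConnectedPart P hpf R S Γ R' S').CoprimePullLaw :=
  coprimePullLaw_of_isMonoprime _ fun _ => P.isMonoprime_pfImage hpf

end RankOneObject

section RankOnePoint

variable {Z : LogDivisorModel.{0}} {G : Type} [Group G] {A : Z.GaloisAction G} (hZ : Z.CuspLaws) (P : RankOnePoint A)
  (hpf : ∀ Y : ((LogDivisorModel.GaloisAction.isConnectedGSet (G := G)).FullSubcategory)ᵒᵖ,
    IsPerfFactorialCof ((DivisorMonoids.ofGaloisActionConnected A hZ).Φ₀.obj Y))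
  (R S : ((Discrete PUnit.{1})ᵒᵖ ⥤ CommMonCat.{0}) → Prop)
  (Γ : Type) [Group Γ] [TopologicalSpace Γ] (R' S' : ((ConnectedPart (BTemp Γ))ᵒᵖ ⥤ CommMonCat.{0}) → Prop)

/-- **✓ at abc-iut-w6-d048's engine `ofRankOnePoint`** (rank-one point of constructed connected Def. 3.3 (iii) data).
[cite: MochizukiEtTh2009, Def 4.1 (i) p.86] -/
theorem coprimePullLaw_ofRankOnePoint : (ofRankOnePoint hZ P hpf R S).CoprimePullLaw :=
  coprimePullLaw_of_isMonoprime _ fun _ => P.isMonoprime_pfImage hZ hpf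

/-- ✓ at its re-basing to the genuine base `B^temp(Π)⁰`. [cite: MochizukiEtTh2009, Def 4.1 (i) p.86] -/
theorem coprimePullLaw_ofRankOnePointConnectedPart :
    (ofRankOnePointConnectedPart hZ P hpf R S Γ R' S').CoprimePullLaw :=
  coprimePullLaw_of_isMonoprime _ fun _ => P.isMonoprime_pfImage hZ hpf

end RankOnePoint

end TemperedFrobenioid

namespace TateTowerFrd

variable (R S : ((Discrete PUnit.{1})ᵒᵖ ⥤ CommMonCat.{0}) → Prop)

/-- **✓ at the MODEL OF RECORD**: abc-iut-w6-d048's tempered Frobenioid over abc-iut-w6-d058's Tate tower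
(`TateTowerFrd.temperedFrobenioid`, the rank-one point `G/G`). [cite: MochizukiEtTh2009, Def 4.1 (i) p.86] -/
theorem coprimePullLaw_temperedFrobenioid : (temperedFrobenioid R S).CoprimePullLaw :=
  TemperedFrobenioid.coprimePullLaw_ofRankOnePoint _ _ _ R S

end TateTowerFrd

end Literature.AnabelianGeometry.EtaleTheta
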